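import Literature.Analysis.FluidPDE.KatoUniquenessPairing
import Literature.Analysis.FluidPDE.KatoL3Uniqueness
import Literature.Analysis.FluidPDE.SolenoidalTruncation
import Literature.Analysis.FluidPDE.MildSolutionProofs
import Literature.Analysis.FluidPDE.MildSolutionHeatFlowProofs
import Literature.Analysis.UnboundedOperators.HeatFlowCalculus
import HarnessLib

/-!
# Restarting mild `C([0,T); L³)` solutions: the two-time duality identity

Analysis/FluidPDE support file, first layer of the discharge of the named fact
`Literature.Analysis.FluidPDE.mild_L3_restart` (`MildL3Smooth.lean`, decomposition of
`NS.mild_L3_smooth`): an unforced mild solution `v` on `[0, T)` from `u₀ ∈ L³` in the tree's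
duality form (`Fluid.IsMildNSSolutionOn (Ico 0 T)`: for every smooth compactly supported
divergence-free `φ`, `⟨v(t), φ⟩ = ⟨u₀, e^{νtΔ}φ⟩ + ∫₀ᵗ ⟨v ⊗ v, ∇e^{ν(t-τ)Δ}φ⟩ dτ`) which lies in
`C([0,T); L³)` and is jointly measurable satisfies the two-time identity
`Fluid.IsMildNSSolutionBetween ν 0 v s t` for all `0 ≤ s ≤ t < T` (Fabes–Jones–Rivière 1972,
Thm. 2.1; Lemarié-Rieusset 2016, Thm. 6.1 and Prop. 6.5: in the classes used very weak solutions
are mild/Oseen solutions, whose Duhamel formula restarts at every time).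

## The proof

Subtract from the identity at time `t` the identity at time `s` *tested with the caloric field*
`ψ = e^{ν(t-s)Δ}φ`; by the semigroup law `e^{νσΔ}ψ = e^{ν(t-s+σ)Δ}φ` the datum terms cancel and
the nonlinear terms combine to `∫ₛᵗ`. The field `ψ` is smooth, divergence free and Schwartz, but
not compactly supported, so the identity at time `s` has to be extended to it. We test instead
with its **solenoidal truncations** `φ_R = χ_R ψ + B(∇χ_R)` (`Fluid.solenoidalTruncation`,
`SolenoidalTruncation.lean`: smooth, compactly supported, divergence free in dimension three, equal
to `ψ` on `‖x‖ < R`, the corrector living on the annulus `R ≤ ‖x‖ ≤ 2R` and bounded by the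
Poincaré field `F(x) = ∫₀¹ τ ψ(τx) dτ`), and let `R → ∞`:

* `|φ_R - ψ| ≤ 1_{‖x‖ ≥ R} (|ψ| + 4C₁ 1_{‖x‖ ≤ 2R} |F|)` with `|F(x)| ≤ C_ψ (1 + ‖x‖)^{-2}`
  (from the decay `(1 + ‖y‖)³ |ψ(y)| ≤ C_ψ` of the caloric extension of a test field), so the
  weights `w_R` are bounded in `L^{3/2}` uniformly in `R` (`∫_{R ≤ ‖x‖ ≤ 2R} (1+‖x‖)^{-3} ≤ 8|B₁|`)
  and tend to `0` in `L³`;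
* `⟨v(s), φ_R⟩ → ⟨v(s), ψ⟩` and `⟨u₀, e^{νsΔ}φ_R⟩ = ⟨e^{νsΔ}u₀, φ_R⟩ → ⟨e^{νsΔ}u₀, ψ⟩`
  (symmetry of the heat semigroup; `L³` tails of `v(s)` and of `e^{νsΔ}u₀` against `w_R`);
* the nonlinear terms differ by `∫₀ˢ ⟨v ⊗ v, ∇e^{ν(s-τ)Δ}(φ_R - ψ)⟩ dτ`, bounded by
  `sup ‖v‖₃² · C (ν(s-τ))^{-1/2} ‖φ_R - ψ‖₃`, integrable in `τ` and `→ 0`.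

## References

* E. B. Fabes, B. F. Jones, N. M. Rivière, *The initial value problem for the Navier–Stokes
  equations with data in `L^p`*, Arch. Rational Mech. Anal. 45 (1972) 222–240, Thm. 2.1.
* P. G. Lemarié-Rieusset, *The Navier–Stokes Problem in the 21st Century*, CRC Press 2016,
  doi:10.1201/b19556, Thm. 6.1, Prop. 6.5 (PDF pp. 134–136), §6.2.
* T. Kato, Math. Z. 187 (1984) 471–480, (1.7).
-/

noncomputable section

open MeasureTheory TopologicalSpace Set Function Filter Topology InnerProductSpace Metric
open scoped RealInnerProductSpace ENNReal NNReal Convolution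

namespace Literature.Analysis.FluidPDE

variable {E : Type*} [NormedAddCommGroup E] [InnerProductSpace ℝ E] [FiniteDimensional ℝ E]
  [MeasurableSpace E] [BorelSpace E]

/-! ### Heat-flow tools: components, symmetry, `Lᵖ` tails -/

section HeatTools

variable {F : Type*} [NormedAddCommGroup F] [NormedSpace ℝ F]
variable {G : Type*} [NormedAddCommGroup G] [NormedSpace ℝ G]

/-- **Continuous linear maps commute with the caloric extension of `Lᵖ` data**:
`L (e^{aΔ} g)(x) = e^{aΔ} (L ∘ g)(x)` for `g ∈ Lᵖ`, `1 ≤ p`, `a > 0` (the convolution integral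
converges absolutely at every point, by Hölder). [folklore] -/
theorem clm_apply_heatExtension_of_memLp [CompleteSpace F] [CompleteSpace G] (L : F →L[ℝ] G)
    {g : E → F} {p : ℝ≥0∞} (hg : MemLp g p volume) (hp : 1 ≤ p) {a : ℝ} (ha : 0 < a) (x : E) :
    L (UnboundedOperators.heatExtension g a x) =
      UnboundedOperators.heatExtension (fun y => L (g y)) a x := by
  rw [UnboundedOperators.heatExtension_apply, UnboundedOperators.heatExtension_apply]
  haveI : p.HolderConjugate (ENNReal.conjExponent p) := .conjExponent hp
  have hq : 1 ≤ ENNReal.conjExponent p :=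
    ENNReal.HolderConjugate.one_le (ENNReal.conjExponent p) p
  have hint : Integrable (fun y => UnboundedOperators.heatKernel a y • g (x - y)) volume := by
    have h := UnboundedOperators.convolutionExistsAt_of_memLp (ContinuousLinearMap.lsmul ℝ ℝ)
      (UnboundedOperators.memLp_heatKernel ha hq) hg x
    simpa [ConvolutionExistsAt] using h
  rw [← ContinuousLinearMap.integral_comp_comm L hint]
  simp only [map_smul]

/-- **Additivity of the caloric extension on `Lᵖ` data** (pointwise, everywhere): for
`f, g ∈ Lᵖ`, `1 ≤ p`, `a > 0`, `e^{aΔ}(f + g) = e^{aΔ}f + e^{aΔ}g`. [folklore] -/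
theorem heatExtension_add_eq_of_memLp {f g : E → F} {p : ℝ≥0∞} (hf : MemLp f p volume)
    (hg : MemLp g p volume) (hp : 1 ≤ p) {a : ℝ} (ha : 0 < a) :
    UnboundedOperators.heatExtension (f + g) a =
      UnboundedOperators.heatExtension f a + UnboundedOperators.heatExtension g a := by
  haveI : p.HolderConjugate (ENNReal.conjExponent p) := .conjExponent hp
  have hq : 1 ≤ ENNReal.conjExponent p :=
    ENNReal.HolderConjugate.one_le (ENNReal.conjExponent p) p
  have hK := UnboundedOperators.memLp_heatKernel (E := E) ha hq
  funext x
  exact ConvolutionExistsAt.distrib_add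
    (UnboundedOperators.convolutionExistsAt_of_memLp (ContinuousLinearMap.lsmul ℝ ℝ) hK hf x)
    (UnboundedOperators.convolutionExistsAt_of_memLp (ContinuousLinearMap.lsmul ℝ ℝ) hK hg x)

/-- **The caloric extension of a difference of `Lᵖ` data** (pointwise, everywhere):
`e^{aΔ}(f - g) = e^{aΔ}f - e^{aΔ}g`. [folklore] -/
theorem heatExtension_sub_eq_of_memLp {f g : E → F} {p : ℝ≥0∞} (hf : MemLp f p volume)
    (hg : MemLp g p volume) (hp : 1 ≤ p) {a : ℝ} (ha : 0 < a) :
    UnboundedOperators.heatExtension (f - g) a =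
      UnboundedOperators.heatExtension f a - UnboundedOperators.heatExtension g a := by
  have h := heatExtension_add_eq_of_memLp (hf.sub hg) hg hp ha
  rw [sub_add_cancel] at h
  exact eq_sub_of_add_eq h.symm

/-- Pairings of `Lᵖ` and `L^q` fields with conjugate exponents are integrable. [folklore] -/
theorem integrable_inner_of_memLp_conj {X : Type*} [MeasurableSpace X] {μ : Measure X}
    {F' : Type*} [NormedAddCommGroup F'] [InnerProductSpace ℝ F'] {u w : X → F'} {p q : ℝ≥0∞}
    [p.HolderConjugate q] (hu : MemLp u p μ) (hw : MemLp w q μ) :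
    Integrable (fun x => ⟪u x, w x⟫) μ := by
  have h1 : MemLp (fun x => ‖u x‖ * ‖w x‖) 1 μ := hw.norm.mul' hu.norm
  refine (memLp_one_iff_integrable.1 h1).mono' (hu.1.inner hw.1) (Eventually.of_forall fun x => ?_)
  rw [Real.norm_eq_abs]
  exact abs_real_inner_le_norm _ _

/-- **Symmetry of the heat semigroup pairing**: `∫⟪f, e^{aΔ}g⟫ = ∫⟪e^{aΔ}f, g⟫` for `f ∈ Lᵖ`,
`g ∈ L^q`, `1/p + 1/q = 1`, `a > 0` (the Gauss–Weierstrass kernel is even; Fubini, through the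
scalar transposition lemma `Literature.Analysis.UnboundedOperators.integral_convolution_mul_eq`
applied to the components in an orthonormal basis). [folklore] -/
theorem integral_inner_heatExtension_comm {f g : E → E} {p q : ℝ≥0∞} [hpq : p.HolderConjugate q]
    (hf : MemLp f p volume) (hg : MemLp g q volume) {a : ℝ} (ha : 0 < a) :
    ∫ x, ⟪f x, UnboundedOperators.heatExtension g a x⟫ =
      ∫ x, ⟪UnboundedOperators.heatExtension f a x, g x⟫ := by
  have hp : 1 ≤ p := ENNReal.HolderConjugate.one_le p q
  have hq : 1 ≤ q := ENNReal.HolderConjugate.one_le q p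
  set b := stdOrthonormalBasis ℝ E with hb
  -- scalar components
  set cf : Fin (Module.finrank ℝ E) → E → ℝ := fun i y => ⟪b i, f y⟫ with hcf
  set cg : Fin (Module.finrank ℝ E) → E → ℝ := fun i y => ⟪b i, g y⟫ with hcg
  have hcf_mem : ∀ i, MemLp (cf i) p volume := fun i => hf.const_inner (b i)
  have hcg_mem : ∀ i, MemLp (cg i) q volume := fun i => hg.const_inner (b i)
  set K : E → ℝ := UnboundedOperators.heatKernel a with hK
  have hK1 : Integrable K := UnboundedOperators.integrable_heatKernel_holds ha
  have hKp : MemLp K p volume := UnboundedOperators.memLp_heatKernel ha hp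
  have hKq : MemLp K q volume := UnboundedOperators.memLp_heatKernel ha hq
  -- components of the caloric extensions
  have hEg : ∀ i x, ⟪b i, UnboundedOperators.heatExtension g a x⟫ =
      (K ⋆[ContinuousLinearMap.lsmul ℝ ℝ, volume] cg i) x := fun i x => by
    have h := clm_apply_heatExtension_of_memLp (innerSL ℝ (b i)) hg hq ha x
    simp only [innerSL_apply_apply] at h
    rw [h]
    rfl
  have hEf : ∀ i x, ⟪b i, UnboundedOperators.heatExtension f a x⟫ =
      (K ⋆[ContinuousLinearMap.lsmul ℝ ℝ, volume] cf i) x := fun i x => by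
    have h := clm_apply_heatExtension_of_memLp (innerSL ℝ (b i)) hf hp ha x
    simp only [innerSL_apply_apply] at h
    rw [h]
    rfl
  have hEg_mem : ∀ i, MemLp (K ⋆[ContinuousLinearMap.lsmul ℝ ℝ, volume] cg i) q volume :=
    fun i => UnboundedOperators.memLp_heatExtension_holds (hcg_mem i) hq ha
  have hEf_mem : ∀ i, MemLp (K ⋆[ContinuousLinearMap.lsmul ℝ ℝ, volume] cf i) p volume :=
    fun i => UnboundedOperators.memLp_heatExtension_holds (hcf_mem i) hp ha
  -- expansion of the pairings
  have hL : ∀ x, ⟪f x, UnboundedOperators.heatExtension g a x⟫ =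
      ∑ i, cf i x * (K ⋆[ContinuousLinearMap.lsmul ℝ ℝ, volume] cg i) x := fun x => by
    rw [← b.sum_inner_mul_inner (f x) (UnboundedOperators.heatExtension g a x)]
    refine Finset.sum_congr rfl fun i _ => ?_
    rw [hEg i x, hcf, real_inner_comm]
  have hR : ∀ x, ⟪UnboundedOperators.heatExtension f a x, g x⟫ =
      ∑ i, (K ⋆[ContinuousLinearMap.lsmul ℝ ℝ, volume] cf i) x * cg i x := fun x => by
    rw [← b.sum_inner_mul_inner (UnboundedOperators.heatExtension f a x) (g x)]
    refine Finset.sum_congr rfl fun i _ => ?_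
    rw [← hEf i x, real_inner_comm]
  simp_rw [hL, hR]
  have hiL : ∀ i, Integrable (fun x => cf i x * (K ⋆[ContinuousLinearMap.lsmul ℝ ℝ, volume] cg i) x)
      volume := fun i => memLp_one_iff_integrable.1 ((hEg_mem i).mul' (hcf_mem i))
  have hiR : ∀ i, Integrable (fun x => (K ⋆[ContinuousLinearMap.lsmul ℝ ℝ, volume] cf i) x * cg i x)
      volume := fun i => memLp_one_iff_integrable.1 ((hcg_mem i).mul' (hEf_mem i))
  rw [integral_finsetSum _ (fun i _ => hiL i), integral_finsetSum _ (fun i _ => hiR i)]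
  refine Finset.sum_congr rfl fun i _ => ?_
  have hKε : ∀ z, K (-z) = 1 * K z := fun z => by
    rw [one_mul, hK, UnboundedOperators.heatKernel_neg]
  have hint := UnboundedOperators.integrable_kernel_mul_mul hK1 hKq (hcf_mem i) (hcg_mem i)
  have h := UnboundedOperators.integral_convolution_mul_eq hKε hint
  rw [one_mul] at h
  exact h.symm

/-- **`Lᵖ` tails vanish**: for `f ∈ Lᵖ`, `1 ≤ p < ∞`, `‖1_{‖x‖ ≥ R} f‖_{Lᵖ} → 0` as `R → ∞`
(dominated convergence). [folklore] -/
theorem tendsto_eLpNorm_indicator_norm_ge {F' : Type*} [NormedAddCommGroup F'] {f : E → F'}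
    {p : ℝ≥0∞} (hp : p ≠ 0) (hp' : p ≠ ∞) (hf : MemLp f p volume) :
    Tendsto (fun R : ℝ => eLpNorm ({x : E | R ≤ ‖x‖}.indicator f) p volume) atTop (𝓝 0) := by
  have hpr : 0 < p.toReal := ENNReal.toReal_pos hp hp'
  -- the `p`-th powers
  have hT : Tendsto (fun R : ℝ => ∫⁻ x, ‖({x : E | R ≤ ‖x‖}.indicator f) x‖ₑ ^ p.toReal) atTop
      (𝓝 0) := by
    have h0 : (0 : ℝ≥0∞) = ∫⁻ _ : E, 0 := by simp
    rw [h0]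
    refine tendsto_lintegral_filter_of_dominated_convergence' (fun x => ‖f x‖ₑ ^ p.toReal)
      (Eventually.of_forall fun R => ?_) (Eventually.of_forall fun R => ?_) ?_ ?_
    · exact ((hf.1.indicator (measurableSet_norm_ge R)).enorm.pow_const _)
    · refine Eventually.of_forall fun x => ?_
      by_cases hx : x ∈ {x : E | R ≤ ‖x‖}
      · rw [indicator_of_mem hx]
      · rw [indicator_of_notMem hx, enorm_zero, ENNReal.zero_rpow_of_pos hpr]
        exact bot_le
    · exact (lintegral_rpow_enorm_lt_top_of_eLpNorm_lt_top hp hp' hf.2).ne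
    · refine Eventually.of_forall fun x => ?_
      refine tendsto_const_nhds.congr' ?_
      filter_upwards [eventually_gt_atTop ‖x‖] with R hR
      rw [indicator_of_notMem (by simpa using hR), enorm_zero, ENNReal.zero_rpow_of_pos hpr]
  have h2 : Tendsto (fun R : ℝ => (∫⁻ x, ‖({x : E | R ≤ ‖x‖}.indicator f) x‖ₑ ^ p.toReal) ^
      (1 / p.toReal)) atTop (𝓝 0) := by
    have h := (ENNReal.continuous_rpow_const (y := 1 / p.toReal)).tendsto 0
    rw [ENNReal.zero_rpow_of_pos (by positivity)] at h
    exact h.comp hT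
  refine h2.congr fun R => ?_
  rw [eLpNorm_eq_lintegral_rpow_enorm_toReal hp hp']

end HeatTools

/-! ### Decay of the caloric extension of a test field and of its Poincaré field -/

section Decay

variable {F : Type*} [NormedAddCommGroup F] [NormedSpace ℝ F]

omit [InnerProductSpace ℝ E] [FiniteDimensional ℝ E] [MeasurableSpace E] [BorelSpace E] in
/-- The weight `1 + ‖·‖` is submultiplicative: `1 + ‖y‖ ≤ (1 + ‖z‖)(1 + ‖y - z‖)`. [folklore] -/
theorem one_add_norm_le_mul_one_add_norm_sub [NormedSpace ℝ E] (y z : E) :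
    1 + ‖y‖ ≤ (1 + ‖z‖) * (1 + ‖y - z‖) := by
  have h : ‖y‖ ≤ ‖z‖ + ‖y - z‖ := by
    calc ‖y‖ = ‖z + (y - z)‖ := by rw [add_sub_cancel]
      _ ≤ ‖z‖ + ‖y - z‖ := norm_add_le _ _
  nlinarith [norm_nonneg z, norm_nonneg (y - z)]

/-- **Polynomial decay of the caloric extension of compactly supported data**: for continuous
compactly supported `φ`, `a > 0` and `k ∈ ℕ` there is `C` with `(1 + ‖y‖)ᵏ ‖e^{aΔ}φ(y)‖ ≤ C` for
all `y` (submultiplicativity of the weight `1 + ‖·‖` moves it onto the Gaussian kernel, where it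
is absorbed, `Literature.Analysis.UnboundedOperators.one_add_pow_mul_exp_neg_mul_sq_le`, and onto
the data). [folklore] -/
theorem exists_weight_pow_mul_norm_heatExtension_le {φ : E → F} (hφ : Continuous φ)
    (hc : HasCompactSupport φ) {a : ℝ} (ha : 0 < a) (k : ℕ) :
    ∃ C : ℝ, 0 ≤ C ∧ ∀ y, (1 + ‖y‖) ^ k * ‖UnboundedOperators.heatExtension φ a y‖ ≤ C := by
  -- the weighted kernel is bounded
  set c : ℝ := (4 * Real.pi * a) ^ (-(Module.finrank ℝ E : ℝ) / 2) with hc_def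
  have hc0 : 0 ≤ c := by positivity
  have hb : 0 < 1 / (4 * a) := by positivity
  set CK : ℝ := c * (k.factorial * Real.exp (1 + 1 / (2 * (1 / (4 * a))))) with hCK
  have hCK0 : 0 ≤ CK := by positivity
  have hKw : ∀ z : E, (1 + ‖z‖) ^ k * UnboundedOperators.heatKernel a z ≤ CK := by
    intro z
    rw [UnboundedOperators.heatKernel_eq]
    have key := UnboundedOperators.one_add_pow_mul_exp_neg_mul_sq_le hb k (norm_nonneg z)
    have hexp : Real.exp (-(1 / (4 * a) / 2) * ‖z‖ ^ 2) ≤ 1 := by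
      rw [Real.exp_le_one_iff]
      nlinarith [sq_nonneg ‖z‖, hb.le]
    calc (1 + ‖z‖) ^ k * (c * Real.exp (-(1 / (4 * a)) * ‖z‖ ^ 2))
        = c * ((1 + ‖z‖) ^ k * Real.exp (-(1 / (4 * a)) * ‖z‖ ^ 2)) := by ring
      _ ≤ c * ((k.factorial * Real.exp (1 + 1 / (2 * (1 / (4 * a))))) *
            Real.exp (-(1 / (4 * a) / 2) * ‖z‖ ^ 2)) := by gcongr
      _ ≤ c * ((k.factorial * Real.exp (1 + 1 / (2 * (1 / (4 * a))))) * 1) := by gcongr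
      _ = CK := by rw [hCK]; ring
  -- the weighted data is integrable
  set Cφ : ℝ := ∫ w, (1 + ‖w‖) ^ k * ‖φ w‖ with hCφ
  have hwφ_cont : Continuous fun w : E => (1 + ‖w‖) ^ k * ‖φ w‖ := by fun_prop
  have hwφ_supp : HasCompactSupport fun w : E => (1 + ‖w‖) ^ k * ‖φ w‖ := hc.norm.mul_left
  have hCφ0 : 0 ≤ Cφ := integral_nonneg fun w => by positivity
  refine ⟨CK * Cφ, by positivity, fun y => ?_⟩
  obtain ⟨M, hM⟩ := hφ.bounded_above_of_compact_support hc
  have hKint : Integrable (UnboundedOperators.heatKernel (E := E) a) :=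
    UnboundedOperators.integrable_heatKernel_holds ha
  have hint1 : Integrable (fun z => UnboundedOperators.heatKernel a z * ‖φ (y - z)‖) :=
    hKint.mul_bdd (hφ.comp (continuous_const.sub continuous_id)).norm.aestronglyMeasurable
      (Eventually.of_forall fun z => by rw [Real.norm_of_nonneg (norm_nonneg _)]; exact hM _)
  have hint2 : Integrable (fun z => CK * ((1 + ‖y - z‖) ^ k * ‖φ (y - z)‖)) := by
    have h : Integrable (fun z => (1 + ‖y - z‖) ^ k * ‖φ (y - z)‖) (volume : Measure E) :=
      (hwφ_cont.integrable_of_hasCompactSupport hwφ_supp).comp_sub_left y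
    exact h.const_mul CK
  -- pointwise comparison of the integrands
  have hpt : ∀ z, (1 + ‖y‖) ^ k * (UnboundedOperators.heatKernel a z * ‖φ (y - z)‖) ≤
      CK * ((1 + ‖y - z‖) ^ k * ‖φ (y - z)‖) := by
    intro z
    have hKz : 0 ≤ UnboundedOperators.heatKernel a z := (UnboundedOperators.heatKernel_pos ha z).le
    have hw : (1 + ‖y‖) ^ k ≤ (1 + ‖z‖) ^ k * (1 + ‖y - z‖) ^ k := by
      rw [← mul_pow]
      exact pow_le_pow_left₀ (by positivity) (one_add_norm_le_mul_one_add_norm_sub y z) k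
    calc (1 + ‖y‖) ^ k * (UnboundedOperators.heatKernel a z * ‖φ (y - z)‖)
        ≤ ((1 + ‖z‖) ^ k * (1 + ‖y - z‖) ^ k) * (UnboundedOperators.heatKernel a z * ‖φ (y - z)‖) := by
          gcongr
      _ = ((1 + ‖z‖) ^ k * UnboundedOperators.heatKernel a z) * ((1 + ‖y - z‖) ^ k * ‖φ (y - z)‖) := by
          ring
      _ ≤ CK * ((1 + ‖y - z‖) ^ k * ‖φ (y - z)‖) := by
          gcongr
          exact hKw z
  -- the estimate
  have hnorm : ‖UnboundedOperators.heatExtension φ a y‖ ≤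
      ∫ z, UnboundedOperators.heatKernel a z * ‖φ (y - z)‖ := by
    rw [UnboundedOperators.heatExtension_apply]
    refine (norm_integral_le_integral_norm _).trans (le_of_eq ?_)
    refine integral_congr_ae (Eventually.of_forall fun z => ?_)
    simp only [norm_smul, Real.norm_of_nonneg (UnboundedOperators.heatKernel_pos ha z).le]
  calc (1 + ‖y‖) ^ k * ‖UnboundedOperators.heatExtension φ a y‖
      ≤ (1 + ‖y‖) ^ k * ∫ z, UnboundedOperators.heatKernel a z * ‖φ (y - z)‖ := by gcongr
    _ = ∫ z, (1 + ‖y‖) ^ k * (UnboundedOperators.heatKernel a z * ‖φ (y - z)‖) :=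
        (integral_const_mul _ _).symm
    _ ≤ ∫ z, CK * ((1 + ‖y - z‖) ^ k * ‖φ (y - z)‖) :=
        integral_mono (hint1.const_mul _) hint2 hpt
    _ = CK * ∫ z, (1 + ‖y - z‖) ^ k * ‖φ (y - z)‖ := integral_const_mul _ _
    _ = CK * Cφ := by
        rw [hCφ, integral_sub_left_eq_self (fun w : E => (1 + ‖w‖) ^ k * ‖φ w‖) volume y]

omit [MeasurableSpace E] [BorelSpace E] in
/-- `∫₀¹ τ (1 + rτ)⁻³ dτ = 1 / (2 (1 + r)²)` for `r ≥ 0` (the primitive is `(τ/(1+rτ))²/2`). [folklore] -/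
theorem integral_mul_one_add_mul_pow_neg_three {r : ℝ} (hr : 0 ≤ r) (C : ℝ) :
    ∫ τ in (0 : ℝ)..1, C * τ / (1 + r * τ) ^ 3 = C / (2 * (1 + r) ^ 2) := by
  have hden : ∀ τ ∈ uIcc (0 : ℝ) 1, 1 + r * τ ≠ 0 := by
    intro τ hτ
    rw [uIcc_of_le zero_le_one] at hτ
    have : 0 ≤ r * τ := mul_nonneg hr hτ.1
    linarith
  have hg : ∀ τ ∈ uIcc (0 : ℝ) 1, HasDerivAt (fun τ : ℝ => τ / (1 + r * τ)) (1 / (1 + r * τ) ^ 2) τ := by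
    intro τ hτ
    have h1 : HasDerivAt (fun τ : ℝ => 1 + r * τ) r τ := by
      simpa using ((hasDerivAt_id τ).const_mul r).const_add 1
    have h := (hasDerivAt_id' τ).fun_div h1 (hden τ hτ)
    refine h.congr_deriv ?_
    field_simp [hden τ hτ]
    ring
  have hf : ∀ τ ∈ uIcc (0 : ℝ) 1,
      HasDerivAt (fun τ : ℝ => C / 2 * (τ / (1 + r * τ)) ^ 2) (C * τ / (1 + r * τ) ^ 3) τ := by
    intro τ hτ
    have h := ((hg τ hτ).fun_pow 2).const_mul (C / 2)
    refine h.congr_deriv ?_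
    have hne := hden τ hτ
    rw [show (2 : ℕ) - 1 = 1 from rfl, pow_one, Nat.cast_ofNat]
    field_simp
  have hcont : ContinuousOn (fun τ : ℝ => C * τ / (1 + r * τ) ^ 3) (uIcc (0 : ℝ) 1) := by
    refine ContinuousOn.div (by fun_prop) (by fun_prop) fun τ hτ => pow_ne_zero 3 (hden τ hτ)
  rw [intervalIntegral.integral_eq_sub_of_hasDerivAt hf (hcont.intervalIntegrable)]
  have h1 : (1 : ℝ) + r * 1 ≠ 0 := hden 1 (by simp)
  simp only [mul_one, mul_zero, add_zero, div_one]
  field_simp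
  ring

omit [FiniteDimensional ℝ E] [MeasurableSpace E] [BorelSpace E] in
/-- **Decay of the Poincaré field**: if `(1 + ‖y‖)³ ‖ψ(y)‖ ≤ C` for all `y`, then
`‖F(x)‖ ≤ C / (2 (1 + ‖x‖)²)` for the Poincaré homotopy field `F(x) = ∫₀¹ τ ψ(τx) dτ`
(`Fluid.poincareField`). [folklore] -/
theorem norm_poincareField_le_of_weight {ψ : E → E} (hψ : Continuous ψ) {C : ℝ}
    (hC : ∀ y, (1 + ‖y‖) ^ 3 * ‖ψ y‖ ≤ C) (x : E) :
    ‖poincareField ψ x‖ ≤ C / (2 * (1 + ‖x‖) ^ 2) := by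
  have hC0 : 0 ≤ C := le_trans (by positivity) (hC 0)
  rw [poincareField_apply]
  have hbound : ∀ τ ∈ Icc (0 : ℝ) 1, ‖τ • ψ (τ • x)‖ ≤ C * τ / (1 + ‖x‖ * τ) ^ 3 := by
    intro τ hτ
    have hτx : ‖τ • x‖ = τ * ‖x‖ := by rw [norm_smul, Real.norm_of_nonneg hτ.1]
    have hpos : 0 < 1 + ‖x‖ * τ := by nlinarith [norm_nonneg x, hτ.1]
    have hψτ : ‖ψ (τ • x)‖ ≤ C / (1 + ‖x‖ * τ) ^ 3 := by
      rw [le_div_iff₀ (pow_pos hpos 3)]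
      have h := hC (τ • x)
      rw [hτx] at h
      nlinarith [h, mul_comm ‖x‖ τ]
    rw [norm_smul, Real.norm_of_nonneg hτ.1]
    calc τ * ‖ψ (τ • x)‖ ≤ τ * (C / (1 + ‖x‖ * τ) ^ 3) := by gcongr; exact hτ.1
      _ = C * τ / (1 + ‖x‖ * τ) ^ 3 := by ring
  have hcont1 : Continuous fun τ : ℝ => τ • ψ (τ • x) := by fun_prop
  have hden : ∀ τ ∈ uIcc (0 : ℝ) 1, 1 + ‖x‖ * τ ≠ 0 := by
    intro τ hτ
    rw [uIcc_of_le zero_le_one] at hτ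
    have : 0 ≤ ‖x‖ * τ := mul_nonneg (norm_nonneg x) hτ.1
    linarith
  have hcont2 : ContinuousOn (fun τ : ℝ => C * τ / (1 + ‖x‖ * τ) ^ 3) (uIcc (0 : ℝ) 1) :=
    ContinuousOn.div (by fun_prop) (by fun_prop) fun τ hτ => pow_ne_zero 3 (hden τ hτ)
  calc ‖∫ τ in (0 : ℝ)..1, τ • ψ (τ • x)‖
      ≤ ∫ τ in (0 : ℝ)..1, ‖τ • ψ (τ • x)‖ :=
        intervalIntegral.norm_integral_le_integral_norm zero_le_one
    _ ≤ ∫ τ in (0 : ℝ)..1, C * τ / (1 + ‖x‖ * τ) ^ 3 :=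
        intervalIntegral.integral_mono_on zero_le_one (hcont1.norm.intervalIntegrable _ _)
          hcont2.intervalIntegrable hbound
    _ = C / (2 * (1 + ‖x‖) ^ 2) := integral_mul_one_add_mul_pow_neg_three (norm_nonneg x) C

end Decay

/-! ### The truncation error: pointwise majorant and its `L^{3/2}`, `L³` sizes -/

section Truncation

/-- The Hölder pair `(3, 3/2)`: `3⁻¹ + (3/2)⁻¹ = 1`. [folklore] -/
theorem holderTriple_three_threeHalves_one : ENNReal.HolderTriple 3 (3 / 2) 1 := by
  refine ⟨?_⟩
  have h : ENNReal.ofReal 3⁻¹ + ENNReal.ofReal (3 / 2)⁻¹ = ENNReal.ofReal 1⁻¹ := by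
    rw [← ENNReal.ofReal_add (by positivity) (by positivity)]
    norm_num
  rw [ENNReal.ofReal_inv_of_pos (by norm_num), ENNReal.ofReal_inv_of_pos (by norm_num),
    ENNReal.ofReal_inv_of_pos (by norm_num), ENNReal.ofReal_ofNat,
    ENNReal.ofReal_div_of_pos (by norm_num), ENNReal.ofReal_ofNat, ENNReal.ofReal_ofNat,
    ENNReal.ofReal_one] at h
  exact h

omit [InnerProductSpace ℝ E] [FiniteDimensional ℝ E] [MeasurableSpace E] [BorelSpace E] in
/-- The annulus weight is nonnegative. [folklore] -/
theorem annulusWeight_nonneg [NormedSpace ℝ E] (R : ℝ) (x : E) :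
    0 ≤ ({x : E | R ≤ ‖x‖ ∧ ‖x‖ ≤ 2 * R}.indicator (fun x : E => ((1 + ‖x‖) ^ 2)⁻¹) x) :=
  Set.indicator_nonneg (fun y _ => by positivity) x

omit [InnerProductSpace ℝ E] [FiniteDimensional ℝ E] [BorelSpace E] in
/-- The annulus `{R ≤ ‖x‖ ≤ 2R}` is measurable. [folklore] -/
theorem measurableSet_annulus [NormedSpace ℝ E] [OpensMeasurableSpace E] (R : ℝ) :
    MeasurableSet {x : E | R ≤ ‖x‖ ∧ ‖x‖ ≤ 2 * R} :=
  (measurableSet_le measurable_const continuous_norm.measurable).inter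
    (measurableSet_le continuous_norm.measurable measurable_const)

omit [InnerProductSpace ℝ E] [FiniteDimensional ℝ E] in
/-- The annulus weight is measurable. [folklore] -/
theorem measurable_annulusWeight [NormedSpace ℝ E] (R : ℝ) :
    Measurable ({x : E | R ≤ ‖x‖ ∧ ‖x‖ ≤ 2 * R}.indicator (fun x : E => ((1 + ‖x‖) ^ 2)⁻¹)) := by
  refine Measurable.indicator ?_ (measurableSet_annulus R)
  exact ((continuous_const.add continuous_norm).pow 2).measurable.inv

/-- **`Lᵖ` size of the annulus weight** in dimension three:
`‖1_{R ≤ ‖x‖ ≤ 2R}(1+‖x‖)⁻²‖_{Lᵖ} ≤ (1+R)⁻² ((2R)³ |B₁|)^{1/p}` for `R > 0`, `0 < p < ∞`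
(the weight is at most `(1+R)⁻²` on the annulus, which lies in the ball of radius `2R`). [folklore] -/
theorem eLpNorm_annulusWeight_le (hE : Module.finrank ℝ E = 3) {R : ℝ} (hR : 0 < R) (p : ℝ≥0∞) :
    eLpNorm (({x : E | R ≤ ‖x‖ ∧ ‖x‖ ≤ 2 * R}.indicator (fun x : E => ((1 + ‖x‖) ^ 2)⁻¹))) p volume ≤
      ENNReal.ofReal (((1 + R) ^ 2)⁻¹) *
        (ENNReal.ofReal ((2 * R) ^ 3) * volume (Metric.ball (0 : E) 1)) ^ (1 / p.toReal) := by
  have hpt : ∀ x : E, ‖({x : E | R ≤ ‖x‖ ∧ ‖x‖ ≤ 2 * R}.indicator (fun x : E => ((1 + ‖x‖) ^ 2)⁻¹) x)‖ ≤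
      ‖(Metric.closedBall (0 : E) (2 * R)).indicator (fun _ => ((1 + R) ^ 2)⁻¹) x‖ := by
    intro x
    by_cases hx : x ∈ {x : E | R ≤ ‖x‖ ∧ ‖x‖ ≤ 2 * R}
    · have hxB : x ∈ Metric.closedBall (0 : E) (2 * R) := by
        rw [Metric.mem_closedBall, dist_zero_right]; exact hx.2
      rw [indicator_of_mem hx, indicator_of_mem hxB, Real.norm_of_nonneg (by positivity),
        Real.norm_of_nonneg (by positivity)]
      gcongr
      linarith [hx.1]
    · rw [indicator_of_notMem hx, norm_zero]
      exact norm_nonneg _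
  calc eLpNorm (({x : E | R ≤ ‖x‖ ∧ ‖x‖ ≤ 2 * R}.indicator (fun x : E => ((1 + ‖x‖) ^ 2)⁻¹))) p volume
      ≤ eLpNorm ((Metric.closedBall (0 : E) (2 * R)).indicator (fun _ => ((1 + R) ^ 2)⁻¹)) p
          volume := eLpNorm_mono hpt
    _ ≤ ‖((1 + R) ^ 2)⁻¹‖ₑ * volume (Metric.closedBall (0 : E) (2 * R)) ^ (1 / p.toReal) :=
        eLpNorm_indicator_const_le _ _
    _ = ENNReal.ofReal (((1 + R) ^ 2)⁻¹) *
        (ENNReal.ofReal ((2 * R) ^ 3) * volume (Metric.ball (0 : E) 1)) ^ (1 / p.toReal) := by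
        rw [Real.enorm_eq_ofReal (by positivity), Measure.addHaar_closedBall _ _ (by positivity), hE]

/-- **The annulus weights are bounded in `L^{3/2}`**, uniformly in `R > 0`:
`‖1_{R≤‖x‖≤2R}(1+‖x‖)⁻²‖_{L^{3/2}} ≤ 4 |B₁|^{2/3}` (`(1+R)⁻² (2R)² ≤ 4`). [folklore] -/
theorem eLpNorm_annulusWeight_threeHalves_le (hE : Module.finrank ℝ E = 3) {R : ℝ} (hR : 0 < R) :
    eLpNorm (({x : E | R ≤ ‖x‖ ∧ ‖x‖ ≤ 2 * R}.indicator (fun x : E => ((1 + ‖x‖) ^ 2)⁻¹))) (3 / 2) volume ≤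
      4 * volume (Metric.ball (0 : E) 1) ^ (2 / 3 : ℝ) := by
  have h32 : (1 : ℝ) / (3 / 2 : ℝ≥0∞).toReal = 2 / 3 := by
    rw [ENNReal.toReal_div, ENNReal.toReal_ofNat, ENNReal.toReal_ofNat]; norm_num
  have h := eLpNorm_annulusWeight_le hE hR (3 / 2)
  rw [h32] at h
  refine h.trans ?_
  rw [ENNReal.mul_rpow_of_nonneg _ _ (by norm_num), ← mul_assoc,
    ENNReal.ofReal_rpow_of_nonneg (by positivity) (by norm_num), ← ENNReal.ofReal_mul (by positivity)]
  gcongr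
  · -- `(1+R)⁻² ((2R)³)^{2/3} = (2R)²/(1+R)² ≤ 4`
    have h1 : ((2 * R) ^ 3) ^ (2 / 3 : ℝ) = (2 * R) ^ 2 := by
      rw [show ((2 * R) ^ 3 : ℝ) = (2 * R) ^ (3 : ℝ) by norm_cast, ← Real.rpow_mul (by positivity)]
      norm_num
    rw [h1, ← ENNReal.ofReal_ofNat]
    refine ENNReal.ofReal_le_ofReal ?_
    rw [inv_mul_le_iff₀ (by positivity)]
    nlinarith

/-- **The annulus weights tend to `0` in `L³`**:
`‖1_{R≤‖x‖≤2R}(1+‖x‖)⁻²‖_{L³} ≤ 2 (1+R)⁻¹ |B₁|^{1/3} → 0`. [folklore] -/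
theorem tendsto_eLpNorm_annulusWeight_three (hE : Module.finrank ℝ E = 3) :
    Tendsto (fun R : ℝ => eLpNorm (({x : E | R ≤ ‖x‖ ∧ ‖x‖ ≤ 2 * R}.indicator (fun x : E => ((1 + ‖x‖) ^ 2)⁻¹))) 3 volume) atTop (𝓝 0) := by
  have hV : volume (Metric.ball (0 : E) 1) ^ (1 / 3 : ℝ) ≠ ⊤ :=
    ENNReal.rpow_ne_top_of_nonneg (by norm_num) measure_ball_lt_top.ne
  have hbound : ∀ᶠ R : ℝ in atTop, eLpNorm (({x : E | R ≤ ‖x‖ ∧ ‖x‖ ≤ 2 * R}.indicator (fun x : E => ((1 + ‖x‖) ^ 2)⁻¹))) 3 volume ≤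
      ENNReal.ofReal (2 / (1 + R)) * volume (Metric.ball (0 : E) 1) ^ (1 / 3 : ℝ) := by
    filter_upwards [eventually_gt_atTop 0] with R hR
    have h := eLpNorm_annulusWeight_le hE hR 3
    rw [ENNReal.toReal_ofNat] at h
    refine h.trans ?_
    rw [ENNReal.mul_rpow_of_nonneg _ _ (by norm_num), ← mul_assoc,
      ENNReal.ofReal_rpow_of_nonneg (by positivity) (by norm_num),
      ← ENNReal.ofReal_mul (by positivity)]
    gcongr
    have h1 : ((2 * R) ^ 3) ^ (1 / 3 : ℝ) = 2 * R := by
      rw [show ((2 * R) ^ 3 : ℝ) = (2 * R) ^ (3 : ℝ) by norm_cast, ← Real.rpow_mul (by positivity)]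
      norm_num
    rw [h1, le_div_iff₀ (by positivity), inv_mul_eq_div, div_mul_eq_mul_div,
      div_le_iff₀ (by positivity)]
    nlinarith
  have hlim : Tendsto (fun R : ℝ => ENNReal.ofReal (2 / (1 + R)) *
      volume (Metric.ball (0 : E) 1) ^ (1 / 3 : ℝ)) atTop (𝓝 0) := by
    have h1 : Tendsto (fun R : ℝ => 2 / (1 + R)) atTop (𝓝 0) :=
      tendsto_const_nhds.div_atTop (tendsto_atTop_add_const_left _ 1 tendsto_id)
    have h2 := ENNReal.tendsto_ofReal h1
    rw [ENNReal.ofReal_zero] at h2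
    have h3 := ENNReal.Tendsto.mul_const h2 (Or.inr hV)
    rwa [zero_mul] at h3
  exact tendsto_of_tendsto_of_tendsto_of_le_of_le' tendsto_const_nhds hlim
    (Eventually.of_forall fun _ => bot_le) hbound

variable {ψ : E → E}

omit [FiniteDimensional ℝ E] [MeasurableSpace E] [BorelSpace E] in
/-- **Pointwise majorant of the solenoidal truncation error.** If `(1 + ‖y‖)³ ‖ψ(y)‖ ≤ C_ψ` and
`‖D(cutoff R)‖ ≤ C₁/R`, then for `R > 0` and all `x`,
`‖Ψ_R(x) - ψ(x)‖ ≤ 1_{R ≤ ‖x‖} ‖ψ(x)‖ + 2C₁C_ψ · 1_{R ≤ ‖x‖ ≤ 2R} (1+‖x‖)⁻²`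
(`Ψ_R = Fluid.solenoidalTruncation ψ R`: it equals `ψ` inside the ball of radius `R`, vanishes
outside `2R`, and in between the corrector is bounded by `4C₁‖F(x)‖` with the Poincaré field
`F`, `norm_solenoidalTruncation_sub_le`, `norm_poincareField_le_of_weight`). [folklore] -/
theorem norm_solenoidalTruncation_sub_le_weights (hψ : Continuous ψ) {Cψ : ℝ}
    (hCψ : ∀ y, (1 + ‖y‖) ^ 3 * ‖ψ y‖ ≤ Cψ) {C₁ : ℝ} (hC₁ : 0 ≤ C₁)
    (hC : ∀ R : ℝ, 0 < R → ∀ x : E, ‖fderiv ℝ (cutoff (E := E) R) x‖ ≤ C₁ / R) {R : ℝ}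
    (hR : 0 < R) (x : E) :
    ‖solenoidalTruncation ψ R x - ψ x‖ ≤
      {x : E | R ≤ ‖x‖}.indicator (fun x => ‖ψ x‖) x + (2 * C₁ * Cψ) * ({x : E | R ≤ ‖x‖ ∧ ‖x‖ ≤ 2 * R}.indicator (fun x : E => ((1 + ‖x‖) ^ 2)⁻¹) x) := by
  have hCψ0 : 0 ≤ Cψ := le_trans (by positivity) (hCψ 0)
  have hw0 : 0 ≤ ({x : E | R ≤ ‖x‖ ∧ ‖x‖ ≤ 2 * R}.indicator (fun x : E => ((1 + ‖x‖) ^ 2)⁻¹) x) := annulusWeight_nonneg R x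
  by_cases h1 : ‖x‖ < R
  · -- inside the ball: no error
    have heq : solenoidalTruncation ψ R x = ψ x :=
      (solenoidalTruncation_eventuallyEq hR h1).eq_of_nhds
    rw [heq, sub_self, norm_zero]
    have : 0 ≤ {x : E | R ≤ ‖x‖}.indicator (fun x => ‖ψ x‖) x :=
      Set.indicator_nonneg (fun y _ => norm_nonneg _) x
    positivity
  · have hxR : R ≤ ‖x‖ := not_lt.1 h1
    have hind1 : {x : E | R ≤ ‖x‖}.indicator (fun x => ‖ψ x‖) x = ‖ψ x‖ :=
      indicator_of_mem (show x ∈ {x : E | R ≤ ‖x‖} from hxR) _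
    rw [hind1]
    by_cases h2 : ‖x‖ ≤ 2 * R
    · -- on the annulus: corrector bounded by the Poincaré field
      have hmem : x ∈ {x : E | R ≤ ‖x‖ ∧ ‖x‖ ≤ 2 * R} := ⟨hxR, h2⟩
      have hw : ({x : E | R ≤ ‖x‖ ∧ ‖x‖ ≤ 2 * R}.indicator (fun x : E => ((1 + ‖x‖) ^ 2)⁻¹) x) = ((1 + ‖x‖) ^ 2)⁻¹ := by
        rw [indicator_of_mem hmem]
      have hF := norm_poincareField_le_of_weight hψ hCψ x
      calc ‖solenoidalTruncation ψ R x - ψ x‖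
          ≤ ‖ψ x‖ + 4 * C₁ * ‖poincareField ψ x‖ := norm_solenoidalTruncation_sub_le hC₁ hC hR x
        _ ≤ ‖ψ x‖ + 4 * C₁ * (Cψ / (2 * (1 + ‖x‖) ^ 2)) := by gcongr
        _ = ‖ψ x‖ + 2 * C₁ * Cψ * ((1 + ‖x‖) ^ 2)⁻¹ := by
            have hne : (1 + ‖x‖) ^ 2 ≠ 0 := by positivity
            field_simp
            ring
        _ = ‖ψ x‖ + 2 * C₁ * Cψ * ({x : E | R ≤ ‖x‖ ∧ ‖x‖ ≤ 2 * R}.indicator (fun x : E => ((1 + ‖x‖) ^ 2)⁻¹) x) := by rw [hw]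
    · -- outside `2R`: the truncation vanishes
      have hzero : solenoidalTruncation ψ R x = 0 :=
        solenoidalTruncation_eq_zero hR (not_le.1 h2)
      rw [hzero, zero_sub, norm_neg]
      have : 0 ≤ 2 * C₁ * Cψ * ({x : E | R ≤ ‖x‖ ∧ ‖x‖ ≤ 2 * R}.indicator (fun x : E => ((1 + ‖x‖) ^ 2)⁻¹) x) := by positivity
      linarith

/-- **Tail pairing bound** (Hölder `3 · 3/2` against a majorant supported off the ball of
radius `R`): if `‖h(x)‖ ≤ w(x)` with `w = 0` on `‖x‖ < R`, `f ∈ L³`, `w ∈ L^{3/2}`, then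
`|∫⟪f, h⟫| ≤ ‖1_{R ≤ ‖x‖} f‖_{L³} ‖w‖_{L^{3/2}}`. [folklore] -/
theorem abs_integral_inner_le_eLpNorm_indicator_mul {f h : E → E} {w : E → ℝ} {R : ℝ}
    (hf : MemLp f 3 volume) (hw : MemLp w (3 / 2) volume)
    (hhw : ∀ x, ‖h x‖ ≤ w x) (hwR : ∀ x, ‖x‖ < R → w x = 0) :
    |∫ x, ⟪f x, h x⟫| ≤
      (eLpNorm ({x : E | R ≤ ‖x‖}.indicator f) 3 volume * eLpNorm w (3 / 2) volume).toReal := by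
  set S : Set E := {x : E | R ≤ ‖x‖} with hS
  have hpt : ∀ x, ‖⟪f x, h x⟫‖ₑ ≤ ‖S.indicator f x‖ₑ * ‖w x‖ₑ := by
    intro x
    have hreal : ‖⟪f x, h x⟫‖ ≤ ‖S.indicator f x‖ * ‖w x‖ := by
      by_cases hx : x ∈ S
      · rw [indicator_of_mem hx, Real.norm_of_nonneg ((norm_nonneg _).trans (hhw x))]
        exact (norm_inner_le_norm _ _).trans (mul_le_mul_of_nonneg_left (hhw x) (norm_nonneg _))
      · have hxR : ‖x‖ < R := not_le.1 hx
        have hw0 : w x = 0 := hwR x hxR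
        have hh0 : h x = 0 := by
          have := hhw x; rw [hw0] at this; exact norm_le_zero_iff.1 this
        rw [hh0, inner_zero_right, norm_zero]
        positivity
    calc ‖⟪f x, h x⟫‖ₑ = ENNReal.ofReal ‖⟪f x, h x⟫‖ := (ofReal_norm _).symm
      _ ≤ ENNReal.ofReal (‖S.indicator f x‖ * ‖w x‖) := ENNReal.ofReal_le_ofReal hreal
      _ = ‖S.indicator f x‖ₑ * ‖w x‖ₑ := by
          rw [ENNReal.ofReal_mul (norm_nonneg _), ofReal_norm, ofReal_norm]
  have hHolder : ∫⁻ x, ‖S.indicator f x‖ₑ * ‖w x‖ₑ ≤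
      eLpNorm (S.indicator f) 3 volume * eLpNorm w (3 / 2) volume := by
    have hpq : Real.HolderConjugate 3 (3 / 2) := Real.holderConjugate_iff.2 ⟨by norm_num, by norm_num⟩
    have hfm : AEMeasurable (fun x => ‖S.indicator f x‖ₑ) volume :=
      (hf.1.indicator (measurableSet_norm_ge R)).enorm
    have hwm : AEMeasurable (fun x => ‖w x‖ₑ) volume := hw.1.enorm
    have h := ENNReal.lintegral_mul_le_Lp_mul_Lq volume hpq hfm hwm
    have e1 : eLpNorm (S.indicator f) 3 volume = (∫⁻ x, ‖S.indicator f x‖ₑ ^ (3 : ℝ)) ^ (1 / (3 : ℝ)) := by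
      rw [eLpNorm_eq_lintegral_rpow_enorm_toReal (by norm_num) (by norm_num), ENNReal.toReal_ofNat]
    have e2 : eLpNorm w (3 / 2) volume = (∫⁻ x, ‖w x‖ₑ ^ (3 / 2 : ℝ)) ^ (1 / (3 / 2 : ℝ)) := by
      rw [eLpNorm_eq_lintegral_rpow_enorm_toReal (by norm_num)
        (ENNReal.div_ne_top (by norm_num) (by norm_num)), ENNReal.toReal_div,
        ENNReal.toReal_ofNat, ENNReal.toReal_ofNat]
    rw [e1, e2]
    simpa only [Pi.mul_apply] using h
  have hfin : eLpNorm (S.indicator f) 3 volume * eLpNorm w (3 / 2) volume ≠ ⊤ :=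
    ENNReal.mul_ne_top (lt_of_le_of_lt (eLpNorm_indicator_le f) hf.2).ne hw.2.ne
  calc |∫ x, ⟪f x, h x⟫| = ‖∫ x, ⟪f x, h x⟫‖ := (Real.norm_eq_abs _).symm
    _ ≤ (∫⁻ x, ‖⟪f x, h x⟫‖ₑ).toReal := by
        have h := norm_integral_le_lintegral_norm (μ := volume) (fun x => ⟪f x, h x⟫)
        simpa only [ofReal_norm] using h
    _ ≤ (eLpNorm (S.indicator f) 3 volume * eLpNorm w (3 / 2) volume).toReal :=
        ENNReal.toReal_mono hfin ((lintegral_mono hpt).trans hHolder)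

end Truncation

/-! ### Limits of the truncated pairings -/

section Limits

/-- **The truncated pairings converge**: for `f ∈ L³` and `ψ` smooth with
`(1 + ‖y‖)³‖ψ(y)‖ ≤ C_ψ`, `ψ ∈ L^{3/2}`, `∫⟪f, Ψ_R⟫ → ∫⟪f, ψ⟫` as `R → ∞`
(`Ψ_R = Fluid.solenoidalTruncation ψ R`; tail pairing bound with the majorant
`1_{R≤‖x‖}‖ψ‖ + 2C₁C_ψ · 1_{R≤‖x‖≤2R}(1+‖x‖)⁻²`, bounded in `L^{3/2}`, against the vanishing `L³`
tails of `f`). [folklore] -/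
theorem tendsto_integral_inner_solenoidalTruncation (hE : Module.finrank ℝ E = 3) {ψ : E → E}
    (hψ : ContDiff ℝ ((⊤ : ℕ∞) : WithTop ℕ∞) ψ) {Cψ : ℝ} (hCψ : ∀ y, (1 + ‖y‖) ^ 3 * ‖ψ y‖ ≤ Cψ)
    (hψ32 : MemLp ψ (3 / 2) volume) {f : E → E} (hf : MemLp f 3 volume) :
    Tendsto (fun R : ℝ => ∫ x, ⟪f x, solenoidalTruncation ψ R x⟫) atTop
      (𝓝 (∫ x, ⟪f x, ψ x⟫)) := by
  haveI : ENNReal.HolderTriple 3 (3 / 2) 1 := holderTriple_three_threeHalves_one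
  have h32le : (1 : ℝ≥0∞) ≤ 3 / 2 := by
    rw [ENNReal.le_div_iff_mul_le (Or.inl two_ne_zero) (Or.inl ENNReal.ofNat_ne_top)]
    norm_num
  obtain ⟨C₁, hC₁, hC⟩ := exists_norm_fderiv_cutoff_le (E := E)
  have hCψ0 : 0 ≤ Cψ := le_trans (by positivity) (hCψ 0)
  set B : ℝ := 2 * C₁ * Cψ with hB
  have hB0 : 0 ≤ B := by positivity
  set V : ℝ≥0∞ := volume (Metric.ball (0 : E) 1) with hV
  have hVtop : V ≠ ⊤ := measure_ball_lt_top.ne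
  set w : ℝ → E → ℝ := fun R x =>
    {x : E | R ≤ ‖x‖}.indicator (fun x => ‖ψ x‖) x + B * ({x : E | R ≤ ‖x‖ ∧ ‖x‖ ≤ 2 * R}.indicator (fun x : E => ((1 + ‖x‖) ^ 2)⁻¹) x) with hw_def
  set Wc : ℝ≥0∞ := eLpNorm ψ (3 / 2) volume + ENNReal.ofReal B * (4 * V ^ (2 / 3 : ℝ)) with hWc
  have hWtop : Wc ≠ ⊤ := ENNReal.add_ne_top.2 ⟨hψ32.2.ne, ENNReal.mul_ne_top ENNReal.ofReal_ne_top
    (ENNReal.mul_ne_top (by norm_num) (ENNReal.rpow_ne_top_of_nonneg (by norm_num) hVtop))⟩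
  have hm1 : ∀ R, AEStronglyMeasurable ({x : E | R ≤ ‖x‖}.indicator (fun x => ‖ψ x‖)) volume :=
    fun R => hψ.continuous.norm.aestronglyMeasurable.indicator (measurableSet_norm_ge R)
  have hm2 : ∀ R, AEStronglyMeasurable (fun x => B * ({x : E | R ≤ ‖x‖ ∧ ‖x‖ ≤ 2 * R}.indicator (fun x : E => ((1 + ‖x‖) ^ 2)⁻¹) x)) volume :=
    fun R => (measurable_annulusWeight R).aestronglyMeasurable.const_mul B
  have hw_meas : ∀ R, AEStronglyMeasurable (w R) volume := fun R => (hm1 R).add (hm2 R)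
  have hW : ∀ R, 0 < R → eLpNorm (w R) (3 / 2) volume ≤ Wc := by
    intro R hR
    have h1 : eLpNorm ({x : E | R ≤ ‖x‖}.indicator (fun x => ‖ψ x‖)) (3 / 2) volume ≤
        eLpNorm ψ (3 / 2) volume := by
      calc _ ≤ eLpNorm (fun x => ‖ψ x‖) (3 / 2) volume := eLpNorm_indicator_le _
        _ = eLpNorm ψ (3 / 2) volume := eLpNorm_norm ψ
    have h2 : eLpNorm (fun x => B * ({x : E | R ≤ ‖x‖ ∧ ‖x‖ ≤ 2 * R}.indicator (fun x : E => ((1 + ‖x‖) ^ 2)⁻¹) x)) (3 / 2) volume ≤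
        ENNReal.ofReal B * (4 * V ^ (2 / 3 : ℝ)) := by
      have h : eLpNorm (fun x => B * ({x : E | R ≤ ‖x‖ ∧ ‖x‖ ≤ 2 * R}.indicator (fun x : E => ((1 + ‖x‖) ^ 2)⁻¹) x)) (3 / 2) volume =
          ‖B‖ₑ * eLpNorm (({x : E | R ≤ ‖x‖ ∧ ‖x‖ ≤ 2 * R}.indicator (fun x : E => ((1 + ‖x‖) ^ 2)⁻¹))) (3 / 2) volume :=
        eLpNorm_const_smul B (({x : E | R ≤ ‖x‖ ∧ ‖x‖ ≤ 2 * R}.indicator (fun x : E => ((1 + ‖x‖) ^ 2)⁻¹))) (3 / 2) volume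
      rw [h, Real.enorm_eq_ofReal hB0]
      gcongr
      exact eLpNorm_annulusWeight_threeHalves_le hE hR
    calc eLpNorm (w R) (3 / 2) volume
        ≤ eLpNorm ({x : E | R ≤ ‖x‖}.indicator (fun x => ‖ψ x‖)) (3 / 2) volume +
          eLpNorm (fun x => B * ({x : E | R ≤ ‖x‖ ∧ ‖x‖ ≤ 2 * R}.indicator (fun x : E => ((1 + ‖x‖) ^ 2)⁻¹) x)) (3 / 2) volume :=
          eLpNorm_add_le (hm1 R) (hm2 R) h32le
      _ ≤ Wc := add_le_add h1 h2
  have hw_mem : ∀ R, 0 < R → MemLp (w R) (3 / 2) volume := fun R hR =>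
    ⟨hw_meas R, (hW R hR).trans_lt (lt_top_iff_ne_top.2 hWtop)⟩
  have hint1 : ∀ R, 0 < R → Integrable (fun x => ⟪f x, solenoidalTruncation ψ R x⟫) volume :=
    fun R hR => integrable_inner_of_memLp_conj (q := 3 / 2) hf
      ((isTestFunctionOn_solenoidalTruncation hψ hR).contDiff.continuous.memLp_of_hasCompactSupport
        (hasCompactSupport_solenoidalTruncation hR))
  have hint2 : Integrable (fun x => ⟪f x, ψ x⟫) volume := integrable_inner_of_memLp_conj hf hψ32
  have hbd : ∀ᶠ R in atTop, |(∫ x, ⟪f x, solenoidalTruncation ψ R x⟫) - ∫ x, ⟪f x, ψ x⟫| ≤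
      (eLpNorm ({x : E | R ≤ ‖x‖}.indicator f) 3 volume * Wc).toReal := by
    filter_upwards [eventually_gt_atTop 0] with R hR
    rw [← integral_sub (hint1 R hR) hint2]
    have heq : (fun x => ⟪f x, solenoidalTruncation ψ R x⟫ - ⟪f x, ψ x⟫) =
        fun x => ⟪f x, solenoidalTruncation ψ R x - ψ x⟫ := by
      funext x; rw [inner_sub_right]
    rw [heq]
    refine (abs_integral_inner_le_eLpNorm_indicator_mul (R := R) hf (hw_mem R hR)
      (fun x => norm_solenoidalTruncation_sub_le_weights hψ.continuous hCψ hC₁ hC hR x)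
      (fun x hx => ?_)).trans ?_
    · have h1 : x ∉ {x : E | R ≤ ‖x‖} := fun h => (not_le.2 hx) h
      have h2 : x ∉ {x : E | R ≤ ‖x‖ ∧ ‖x‖ ≤ 2 * R} := fun h => (not_le.2 hx) h.1
      simp only [hw_def, indicator_of_notMem h1, indicator_of_notMem h2, mul_zero,
        add_zero]
    · exact ENNReal.toReal_mono
        (ENNReal.mul_ne_top (lt_of_le_of_lt (eLpNorm_indicator_le f) hf.2).ne hWtop)
        (mul_le_mul' le_rfl (hW R hR))
  have h0 : Tendsto (fun R : ℝ => (eLpNorm ({x : E | R ≤ ‖x‖}.indicator f) 3 volume * Wc).toReal)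
      atTop (𝓝 0) := by
    have h1 := tendsto_eLpNorm_indicator_norm_ge (by norm_num) (by norm_num) hf
    have h2 := ENNReal.Tendsto.mul_const h1 (Or.inr hWtop)
    rw [zero_mul] at h2
    have h3 := (ENNReal.tendsto_toReal ENNReal.zero_ne_top).comp h2
    rwa [ENNReal.toReal_zero] at h3
  rw [tendsto_iff_norm_sub_tendsto_zero]
  refine squeeze_zero' (Eventually.of_forall fun R => norm_nonneg _) ?_ h0
  filter_upwards [hbd] with R hR
  rwa [Real.norm_eq_abs]

/-- **The truncation error tends to `0` in `L³`**: `‖Ψ_R - ψ‖_{L³} → 0` for `ψ` smooth with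
`(1 + ‖y‖)³‖ψ(y)‖ ≤ C_ψ`, `ψ ∈ L³` (majorant `1_{R≤‖x‖}‖ψ‖ + 2C₁C_ψ · 1_{R≤‖x‖≤2R}(1+‖x‖)⁻²`). [folklore] -/
theorem tendsto_eLpNorm_solenoidalTruncation_sub (hE : Module.finrank ℝ E = 3) {ψ : E → E}
    (hψ : ContDiff ℝ ((⊤ : ℕ∞) : WithTop ℕ∞) ψ) {Cψ : ℝ} (hCψ : ∀ y, (1 + ‖y‖) ^ 3 * ‖ψ y‖ ≤ Cψ)
    (hψ3 : MemLp ψ 3 volume) :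
    Tendsto (fun R : ℝ => eLpNorm (fun x => solenoidalTruncation ψ R x - ψ x) 3 volume) atTop
      (𝓝 0) := by
  obtain ⟨C₁, hC₁, hC⟩ := exists_norm_fderiv_cutoff_le (E := E)
  have hCψ0 : 0 ≤ Cψ := le_trans (by positivity) (hCψ 0)
  set B : ℝ := 2 * C₁ * Cψ with hB
  have hB0 : 0 ≤ B := by positivity
  have hm1 : ∀ R, AEStronglyMeasurable (fun x => ‖({x : E | R ≤ ‖x‖}.indicator ψ) x‖) volume :=
    fun R => (hψ.continuous.aestronglyMeasurable.indicator (measurableSet_norm_ge R)).norm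
  have hm2 : ∀ R, AEStronglyMeasurable (fun x => B * ({x : E | R ≤ ‖x‖ ∧ ‖x‖ ≤ 2 * R}.indicator (fun x : E => ((1 + ‖x‖) ^ 2)⁻¹) x)) volume :=
    fun R => (measurable_annulusWeight R).aestronglyMeasurable.const_mul B
  have hbd : ∀ᶠ R in atTop, eLpNorm (fun x => solenoidalTruncation ψ R x - ψ x) 3 volume ≤
      eLpNorm ({x : E | R ≤ ‖x‖}.indicator ψ) 3 volume +
        ENNReal.ofReal B * eLpNorm (({x : E | R ≤ ‖x‖ ∧ ‖x‖ ≤ 2 * R}.indicator (fun x : E => ((1 + ‖x‖) ^ 2)⁻¹))) 3 volume := by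
    filter_upwards [eventually_gt_atTop 0] with R hR
    have hpt : ∀ x, ‖solenoidalTruncation ψ R x - ψ x‖ ≤
        ‖({x : E | R ≤ ‖x‖}.indicator ψ) x‖ + B * ({x : E | R ≤ ‖x‖ ∧ ‖x‖ ≤ 2 * R}.indicator (fun x : E => ((1 + ‖x‖) ^ 2)⁻¹) x) := by
      intro x
      have h := norm_solenoidalTruncation_sub_le_weights hψ.continuous hCψ hC₁ hC hR x
      rwa [norm_indicator_eq_indicator_norm]
    have h2 : eLpNorm (fun x => B * ({x : E | R ≤ ‖x‖ ∧ ‖x‖ ≤ 2 * R}.indicator (fun x : E => ((1 + ‖x‖) ^ 2)⁻¹) x)) 3 volume =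
        ENNReal.ofReal B * eLpNorm (({x : E | R ≤ ‖x‖ ∧ ‖x‖ ≤ 2 * R}.indicator (fun x : E => ((1 + ‖x‖) ^ 2)⁻¹))) 3 volume := by
      rw [← Real.enorm_eq_ofReal hB0]
      exact eLpNorm_const_smul B (({x : E | R ≤ ‖x‖ ∧ ‖x‖ ≤ 2 * R}.indicator (fun x : E => ((1 + ‖x‖) ^ 2)⁻¹))) 3 volume
    calc eLpNorm (fun x => solenoidalTruncation ψ R x - ψ x) 3 volume
        ≤ eLpNorm (fun x => ‖({x : E | R ≤ ‖x‖}.indicator ψ) x‖ + B * ({x : E | R ≤ ‖x‖ ∧ ‖x‖ ≤ 2 * R}.indicator (fun x : E => ((1 + ‖x‖) ^ 2)⁻¹) x)) 3 volume :=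
          eLpNorm_mono_real hpt
      _ ≤ eLpNorm (fun x => ‖({x : E | R ≤ ‖x‖}.indicator ψ) x‖) 3 volume +
            eLpNorm (fun x => B * ({x : E | R ≤ ‖x‖ ∧ ‖x‖ ≤ 2 * R}.indicator (fun x : E => ((1 + ‖x‖) ^ 2)⁻¹) x)) 3 volume :=
          eLpNorm_add_le (hm1 R) (hm2 R) (by norm_num)
      _ = eLpNorm ({x : E | R ≤ ‖x‖}.indicator ψ) 3 volume +
            ENNReal.ofReal B * eLpNorm (({x : E | R ≤ ‖x‖ ∧ ‖x‖ ≤ 2 * R}.indicator (fun x : E => ((1 + ‖x‖) ^ 2)⁻¹))) 3 volume := by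
          rw [eLpNorm_norm, h2]
  have hlim : Tendsto (fun R : ℝ => eLpNorm ({x : E | R ≤ ‖x‖}.indicator ψ) 3 volume +
      ENNReal.ofReal B * eLpNorm (({x : E | R ≤ ‖x‖ ∧ ‖x‖ ≤ 2 * R}.indicator (fun x : E => ((1 + ‖x‖) ^ 2)⁻¹))) 3 volume) atTop (𝓝 0) := by
    have h1 := tendsto_eLpNorm_indicator_norm_ge (by norm_num) (by norm_num) hψ3
    have h2 := ENNReal.Tendsto.const_mul (tendsto_eLpNorm_annulusWeight_three hE)
      (Or.inr ENNReal.ofReal_ne_top) (a := ENNReal.ofReal B)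
    rw [mul_zero] at h2
    simpa using h1.add h2
  exact tendsto_of_tendsto_of_tendsto_of_le_of_le' tendsto_const_nhds hlim
    (Eventually.of_forall fun _ => bot_le) hbd

end Limits

/-! ### The two-time identity -/

section Restart

variable {ν T : ℝ} {u₀ : E → E} {v : ℝ → E → E}

/-- **Restart of mild `C([0,T); L³)` solutions: the two-time duality identity**
(Fabes–Jones–Rivière 1972, Thm. 2.1; Lemarié-Rieusset 2016, Thm. 6.1 and Prop. 6.5; Kato 1984,
(1.7)). On a three-dimensional space, let `ν > 0`, `u₀ ∈ L³`, and let `v` be an unforced mild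
solution on `[0, T)` from `u₀` in the duality form, with `v ∈ C([0,T); L³)` and `v` jointly
measurable on `(0,T) × E`. Then `Fluid.IsMildNSSolutionBetween ν 0 v s t` for all
`0 ≤ s ≤ t < T`. Proof in the module docstring (solenoidal truncations of the caloric test field
`e^{ν(t-s)Δ}φ`, `L³` tails, symmetry and semigroup law of the heat flow). [cite: FabesJonesRiviere1972, Thm. 2.1] [cite: LemarieRieusset2016, Thm. 6.1 and Prop. 6.5] -/
theorem IsMildNSSolutionOn.isMildNSSolutionBetween_of_continuousInLpOn_three
    (hE : Module.finrank ℝ E = 3) (hν : 0 < ν) (hu₀ : MemLp u₀ 3 volume)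
    (hv : IsMildNSSolutionOn (Ico 0 T) ν 0 u₀ v) (hvc : ContinuousInLpOn (Ico 0 T) 3 v)
    (hmeas : AEStronglyMeasurable (uncurry v) (volume.restrict (Ioo 0 T ×ˢ univ)))
    {s t : ℝ} (hs : 0 ≤ s) (hst : s ≤ t) (ht : t < T) :
    IsMildNSSolutionBetween ν 0 v s t := by
  rcases hst.eq_or_lt with rfl | hst'
  · exact IsMildNSSolutionBetween.refl ν 0 v s
  intro φ hφ hdiv
  haveI : ENNReal.HolderTriple 3 (3 / 2) 1 := holderTriple_three_threeHalves_one
  have h32le : (1 : ℝ≥0∞) ≤ 3 / 2 := by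
    rw [ENNReal.le_div_iff_mul_le (Or.inl two_ne_zero) (Or.inl ENNReal.ofNat_ne_top)]
    norm_num
  have hsT : s ∈ Ico 0 T := ⟨hs, hst'.trans ht⟩
  have htT : t ∈ Ico 0 T := ⟨hs.trans hst, ht⟩
  have hφ1 : ContDiff ℝ 1 φ := hφ.contDiff.of_le (by exact_mod_cast le_top)
  have hφc : HasCompactSupport φ := hφ.hasCompactSupport
  have hφp : ∀ p : ℝ≥0∞, MemLp φ p volume := fun p =>
    hφ.contDiff.continuous.memLp_of_hasCompactSupport hφc
  -- the caloric test field `ψ = e^{ν(t-s)Δ}φ`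
  have hts : 0 < t - s := sub_pos.2 hst'
  have ha : 0 < ν * (t - s) := mul_pos hν hts
  set ψ : E → E := heatTest ν φ (t - s) with hψ_def
  have hψ_eq : ψ = UnboundedOperators.heatExtension φ (ν * (t - s)) := heatTest_of_pos hν hts φ
  have hψ_smooth : ContDiff ℝ ((⊤ : ℕ∞) : WithTop ℕ∞) ψ := contDiff_heatFlow hφ.contDiff hφc _
  have hψ_div : VectorCalculus.IsDivFree ψ := isDivFree_heatFlow hφ1 hφc hdiv _
  have hψ_mem : ∀ p : ℝ≥0∞, 1 ≤ p → MemLp ψ p volume := fun p hp =>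
    memLp_heatFlow_holds (hφp p) hp ha.le
  obtain ⟨Cψ, hCψ0, hCψ⟩ : ∃ C : ℝ, 0 ≤ C ∧ ∀ y, (1 + ‖y‖) ^ 3 * ‖ψ y‖ ≤ C := by
    rw [hψ_eq]
    exact exists_weight_pow_mul_norm_heatExtension_le hφ.contDiff.continuous hφc ha 3
  -- the semigroup law: `e^{νσΔ}ψ = e^{ν(t-s+σ)Δ}φ`
  have hsemi : ∀ σ : ℝ, 0 ≤ σ → heatTest ν ψ σ = heatTest ν φ (t - s + σ) := by
    intro σ hσ
    change heatFlow (heatFlow φ (ν * (t - s))) (ν * σ) = heatFlow φ (ν * (t - s + σ))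
    rw [heatFlow_heatFlow_holds (hφp 2) (by norm_num) ha.le (mul_nonneg hν.le hσ)]
    congr 1
    ring
  -- uniform `L³` bound of `v` on `[0, t]`
  obtain ⟨M, hM⟩ := ContinuousInLpOn.exists_forall_eLpNorm_le hvc (by norm_num) isCompact_Icc
    (show Icc 0 t ⊆ Ico 0 T from fun τ hτ => ⟨hτ.1, hτ.2.trans_lt ht⟩)
  -- the nonlinear integrand with the test `φ` at final time `t`
  set N : ℝ → ℝ := fun τ => ∫ x, ⟪v τ x, convect (v τ) (heatTest ν φ (t - τ)) x⟫ with hN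
  have hN_int : IntervalIntegrable N volume 0 t := by
    have h := intervalIntegrable_transportPairing hν hφ1 hφc (hs.trans hst) ht.le hmeas hmeas
      (ENNReal.coe_lt_top (r := M)) (ENNReal.coe_lt_top (r := M))
      (fun τ hτ => ⟨hvc.1 τ ⟨hτ.1, hτ.2.trans_lt ht⟩, hM τ hτ⟩)
      (fun τ hτ => ⟨hvc.1 τ ⟨hτ.1, hτ.2.trans_lt ht⟩, hM τ hτ⟩)
    simpa only [hN, convect] using h
  have hN_int_s : IntervalIntegrable N volume 0 s :=
    hN_int.mono_set (by
      rw [uIcc_of_le hs, uIcc_of_le (hs.trans hst)]; exact Icc_subset_Icc_right hst)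
  have hN_int_st : IntervalIntegrable N volume s t :=
    hN_int.mono_set (by
      rw [uIcc_of_le hst, uIcc_of_le (hs.trans hst)]; exact Icc_subset_Icc_left hs)
  -- ### Step A: the identity at time `s`, tested with `ψ`
  have hA : ∫ x, ⟪v s x, ψ x⟫ = (∫ x, ⟪u₀ x, heatTest ν φ t x⟫) + ∫ τ in 0..s, N τ := by
    -- the truncations are admissible tests
    have hR_test : ∀ R : ℝ, 0 < R →
        FunctionSpaces.IsTestFunctionOn (⊤ : Opens E) (solenoidalTruncation ψ R) := fun R hR =>
      isTestFunctionOn_solenoidalTruncation hψ_smooth hR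
    have hR_div : ∀ R : ℝ, VectorCalculus.IsDivFree (solenoidalTruncation ψ R) := fun R =>
      isDivFree_solenoidalTruncation hE (hψ_smooth.of_le (by exact_mod_cast le_top)) hψ_div R
    have hR_mem : ∀ R : ℝ, 0 < R → ∀ p : ℝ≥0∞, MemLp (solenoidalTruncation ψ R) p volume :=
      fun R hR p => (hR_test R hR).contDiff.continuous.memLp_of_hasCompactSupport
        (hasCompactSupport_solenoidalTruncation hR)
    -- the identity at time `s` with the test `Ψ_R`
    set NR : ℝ → ℝ → ℝ := fun R τ =>
      ∫ x, ⟪v τ x, convect (v τ) (heatTest ν (solenoidalTruncation ψ R) (s - τ)) x⟫ with hNR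
    have hIdR : ∀ R : ℝ, 0 < R → ∫ x, ⟪v s x, solenoidalTruncation ψ R x⟫ =
        (∫ x, ⟪u₀ x, heatTest ν (solenoidalTruncation ψ R) s x⟫) + ∫ τ in 0..s, NR R τ := by
      intro R hR
      have h := hv.2 s hsT _ (hR_test R hR) (hR_div R)
      simpa only [Pi.zero_apply, inner_zero_left, integral_zero, intervalIntegral.integral_zero,
        add_zero] using h
    -- (a) the left-hand sides converge
    have hLa : Tendsto (fun R : ℝ => ∫ x, ⟪v s x, solenoidalTruncation ψ R x⟫) atTop
        (𝓝 (∫ x, ⟪v s x, ψ x⟫)) :=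
      tendsto_integral_inner_solenoidalTruncation hE hψ_smooth hCψ
        (hψ_mem _ h32le) (hvc.1 s hsT)
    -- (b) the datum terms converge
    have hLb : Tendsto (fun R : ℝ => ∫ x, ⟪u₀ x, heatTest ν (solenoidalTruncation ψ R) s x⟫) atTop
        (𝓝 (∫ x, ⟪u₀ x, heatTest ν φ t x⟫)) := by
      set f₀ : E → E := heatFlow u₀ (ν * s) with hf₀_def
      have hf₀ : MemLp f₀ 3 volume := memLp_heatFlow_holds hu₀ (by norm_num) (mul_nonneg hν.le hs)
      have hsymm : ∀ g : E → E, MemLp g (3 / 2) volume →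
          ∫ x, ⟪u₀ x, heatTest ν g s x⟫ = ∫ x, ⟪f₀ x, g x⟫ := by
        intro g hg
        change ∫ x, ⟪u₀ x, heatFlow g (ν * s) x⟫ = ∫ x, ⟪heatFlow u₀ (ν * s) x, g x⟫
        rcases (mul_nonneg hν.le hs).eq_or_lt with h0 | hpos
        · rw [← h0, heatFlow_zero, heatFlow_zero]
        · rw [heatFlow_of_pos _ hpos, heatFlow_of_pos _ hpos]
          exact integral_inner_heatExtension_comm hu₀ hg hpos
      have h2 : ∫ x, ⟪u₀ x, heatTest ν φ t x⟫ = ∫ x, ⟪f₀ x, ψ x⟫ := by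
        rw [← hsymm ψ (hψ_mem _ h32le), hsemi s hs]
        congr 1
        funext x
        congr 2
        ring
      rw [h2]
      refine (tendsto_integral_inner_solenoidalTruncation hE hψ_smooth hCψ
        (hψ_mem _ h32le) hf₀).congr' ?_
      filter_upwards [eventually_gt_atTop 0] with R hR
      exact (hsymm _ (hR_mem R hR _)).symm
    -- (c) the nonlinear terms converge
    have hLc : Tendsto (fun R : ℝ => ∫ τ in 0..s, NR R τ) atTop (𝓝 (∫ τ in 0..s, N τ)) := by
      have hNR_int : ∀ R : ℝ, 0 < R → IntervalIntegrable (NR R) volume 0 s := by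
        intro R hR
        have h := intervalIntegrable_transportPairing hν
          ((hR_test R hR).contDiff.of_le (by exact_mod_cast le_top))
          (hasCompactSupport_solenoidalTruncation hR) hs hsT.2.le hmeas hmeas
          (ENNReal.coe_lt_top (r := M)) (ENNReal.coe_lt_top (r := M))
          (fun τ hτ => ⟨hvc.1 τ ⟨hτ.1, hτ.2.trans_lt hsT.2⟩, hM τ ⟨hτ.1, hτ.2.trans hst⟩⟩)
          (fun τ hτ => ⟨hvc.1 τ ⟨hτ.1, hτ.2.trans_lt hsT.2⟩, hM τ ⟨hτ.1, hτ.2.trans hst⟩⟩)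
        simpa only [hNR, convect] using h
      -- the gradient smoothing constant, `p = q = 3`
      obtain ⟨Cg, hCg⟩ := UnboundedOperators.eLpNorm_fderiv_heatExtension_le_rpow
        (E := E) (F := E) (p := 3) (q := 3) (by norm_num) le_rfl
      have hCg' : ∀ g : E → E, MemLp g 3 volume → ∀ r : ℝ, 0 < r →
          eLpNorm (fderiv ℝ (UnboundedOperators.heatExtension g r)) 3 volume ≤
            Cg * ENNReal.ofReal (r ^ (-(1 / 2 : ℝ))) * eLpNorm g 3 volume := by
        intro g hg r hr
        have h := hCg g hg r hr
        simp only [sub_self, mul_zero, sub_zero] at h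
        exact h
      -- the truncation error in `L³`
      set d : ℝ → ℝ≥0∞ := fun R => eLpNorm (fun x => solenoidalTruncation ψ R x - ψ x) 3 volume
        with hd_def
      have hd_top : ∀ R : ℝ, 0 < R → d R ≠ ⊤ := fun R hR =>
        ((hR_mem R hR 3).sub (hψ_mem 3 (by norm_num))).2.ne
      have hd_lim : Tendsto d atTop (𝓝 0) :=
        tendsto_eLpNorm_solenoidalTruncation_sub hE hψ_smooth hCψ (hψ_mem 3 (by norm_num))
      -- pointwise-in-time bound of the difference of the nonlinear integrands
      set K : ℝ := (M : ℝ) ^ 2 * Cg * ν ^ (-(1 / 2 : ℝ)) with hK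
      have hK0 : 0 ≤ K := by positivity
      have hbdτ : ∀ R : ℝ, 0 < R → ∀ τ ∈ Ioo 0 s,
          ‖NR R τ - N τ‖ ≤ K * (s - τ) ^ (-(1 / 2 : ℝ)) * (d R).toReal := by
        intro R hR τ hτ
        have hτT : τ ∈ Ico 0 T := ⟨hτ.1.le, hτ.2.trans hsT.2⟩
        have hv3 : MemLp (v τ) 3 volume := hvc.1 τ hτT
        have hvM : eLpNorm (v τ) 3 volume ≤ M := hM τ ⟨hτ.1.le, hτ.2.le.trans hst⟩
        have hστ : 0 < s - τ := sub_pos.2 hτ.2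
        have hr : 0 < ν * (s - τ) := mul_pos hν hστ
        set ΨR : E → E →L[ℝ] E := fderiv ℝ (heatTest ν (solenoidalTruncation ψ R) (s - τ))
          with hΨR
        set Ψ : E → E →L[ℝ] E := fderiv ℝ (heatTest ν φ (t - τ)) with hΨ
        have hΨR3 : MemLp ΨR 3 volume :=
          memLp_fderiv_heatTest hν hστ.le ((hR_test R hR).contDiff.of_le (by exact_mod_cast le_top))
            (hasCompactSupport_solenoidalTruncation hR) (by norm_num)
        have hΨ3 : MemLp Ψ 3 volume :=
          memLp_fderiv_heatTest hν (by linarith) hφ1 hφc (by norm_num)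
        -- the difference of the operator fields is the gradient of `e^{ν(s-τ)Δ}(Ψ_R - ψ)`
        have hgR : heatTest ν (solenoidalTruncation ψ R) (s - τ) =
            UnboundedOperators.heatExtension (solenoidalTruncation ψ R) (ν * (s - τ)) :=
          heatTest_of_pos hν hστ _
        have hgψ : heatTest ν φ (t - τ) = UnboundedOperators.heatExtension ψ (ν * (s - τ)) := by
          have h1 : heatTest ν φ (t - τ) = heatTest ν ψ (s - τ) := by
            rw [hsemi (s - τ) hστ.le]; congr 1; ring
          rw [h1]
          exact heatTest_of_pos hν hστ _
        have hdiffeq : (fun x => ΨR x - Ψ x) = fderiv ℝ (UnboundedOperators.heatExtension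
            (fun y => solenoidalTruncation ψ R y - ψ y) (ν * (s - τ))) := by
          have hsub : UnboundedOperators.heatExtension (fun y => solenoidalTruncation ψ R y - ψ y)
              (ν * (s - τ)) = UnboundedOperators.heatExtension (solenoidalTruncation ψ R)
                (ν * (s - τ)) - UnboundedOperators.heatExtension ψ (ν * (s - τ)) :=
            heatExtension_sub_eq_of_memLp (hR_mem R hR 3) (hψ_mem 3 (by norm_num)) (by norm_num) hr
          have hd1 : Differentiable ℝ (UnboundedOperators.heatExtension (solenoidalTruncation ψ R)
              (ν * (s - τ))) :=
            (UnboundedOperators.contDiff_heatExtension_holds (hR_mem R hR 3) (by norm_num) hr).differentiable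
              (by simp)
          have hd2 : Differentiable ℝ (UnboundedOperators.heatExtension ψ (ν * (s - τ))) :=
            (UnboundedOperators.contDiff_heatExtension_holds (hψ_mem 3 (by norm_num)) (by norm_num) hr).differentiable
              (by simp)
          rw [hsub]
          funext x
          rw [hΨR, hΨ, hgR, hgψ, fderiv_sub (hd1 x) (hd2 x)]
        -- the difference of the nonlinear terms as one integral
        have hi1 := (integral_inner_clm_apply_le hv3 hv3 hΨR3).1
        have hi2 := (integral_inner_clm_apply_le hv3 hv3 hΨ3).1
        have hsub : NR R τ - N τ = ∫ x, ⟪v τ x, (ΨR x - Ψ x) (v τ x)⟫ := by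
          simp only [hNR, hN, convect]
          rw [← integral_sub hi1 hi2]
          refine integral_congr_ae (Eventually.of_forall fun x => ?_)
          simp only [FunLike.coe_sub, Pi.sub_apply, inner_sub_right, hΨR, hΨ]
        have hD3 : MemLp (fun x => ΨR x - Ψ x) 3 volume := hΨR3.sub hΨ3
        have hbound := (integral_inner_clm_apply_le hv3 hv3 hD3).2
        have hgrad : eLpNorm (fun x => ΨR x - Ψ x) 3 volume ≤
            Cg * ENNReal.ofReal ((ν * (s - τ)) ^ (-(1 / 2 : ℝ))) * d R := by
          rw [hdiffeq]
          exact hCg' _ ((hR_mem R hR 3).sub (hψ_mem 3 (by norm_num))) _ hr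
        have hfin : (M : ℝ≥0∞) * (Cg * ENNReal.ofReal ((ν * (s - τ)) ^ (-(1 / 2 : ℝ))) * d R) * M ≠ ⊤ :=
          ENNReal.mul_ne_top (ENNReal.mul_ne_top ENNReal.coe_ne_top
            (ENNReal.mul_ne_top (ENNReal.mul_ne_top ENNReal.coe_ne_top ENNReal.ofReal_ne_top)
              (hd_top R hR))) ENNReal.coe_ne_top
        rw [Real.norm_eq_abs, hsub]
        refine hbound.trans ?_
        have hle : eLpNorm (v τ) 3 volume * eLpNorm (fun x => ΨR x - Ψ x) 3 volume *
            eLpNorm (v τ) 3 volume ≤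
            (M : ℝ≥0∞) * (Cg * ENNReal.ofReal ((ν * (s - τ)) ^ (-(1 / 2 : ℝ))) * d R) * M :=
          mul_le_mul' (mul_le_mul' hvM hgrad) hvM
        refine (ENNReal.toReal_mono hfin hle).trans (le_of_eq ?_)
        have hνst : (ν * (s - τ)) ^ (-(1 / 2 : ℝ)) = ν ^ (-(1 / 2 : ℝ)) * (s - τ) ^ (-(1 / 2 : ℝ)) :=
          Real.mul_rpow hν.le hστ.le
        rw [ENNReal.toReal_mul, ENNReal.toReal_mul, ENNReal.toReal_mul, ENNReal.toReal_mul,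
          ENNReal.toReal_ofReal (by positivity), ENNReal.coe_toReal, ENNReal.coe_toReal, hνst, hK]
        ring
      -- the bound is integrable on `(0, s)`
      have hb_int : IntervalIntegrable (fun τ : ℝ => K * (s - τ) ^ (-(1 / 2 : ℝ))) volume 0 s := by
        have h := (intervalIntegral.intervalIntegrable_rpow' (a := 0) (b := s) (r := -(1 / 2 : ℝ))
          (by norm_num)).comp_sub_left s
        simp only [sub_zero, sub_self] at h
        exact (h.symm).const_mul K
      -- hence the integrals differ by `≤ (∫ K (s-τ)^{-1/2}) ‖Ψ_R - ψ‖₃ → 0`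
      have hdiffint : ∀ᶠ R : ℝ in atTop, ‖(∫ τ in 0..s, NR R τ) - ∫ τ in 0..s, N τ‖ ≤
          (∫ τ in 0..s, K * (s - τ) ^ (-(1 / 2 : ℝ))) * (d R).toReal := by
        filter_upwards [eventually_gt_atTop 0] with R hR
        rw [← intervalIntegral.integral_sub (hNR_int R hR) hN_int_s,
          ← intervalIntegral.integral_mul_const]
        refine intervalIntegral.norm_integral_le_of_norm_le hs ?_ (hb_int.mul_const _)
        have hne : ∀ᵐ τ : ℝ ∂volume, τ ≠ s := by
          have h : volume ({s} : Set ℝ) = 0 := Real.volume_singleton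
          exact measure_eq_zero_iff_ae_notMem.1 h
        filter_upwards [hne] with τ hτs hτ
        exact hbdτ R hR τ ⟨hτ.1, lt_of_le_of_ne hτ.2 hτs⟩
      have hlim0 : Tendsto (fun R : ℝ => (∫ τ in 0..s, K * (s - τ) ^ (-(1 / 2 : ℝ))) * (d R).toReal)
          atTop (𝓝 0) := by
        have h1 := (ENNReal.tendsto_toReal ENNReal.zero_ne_top).comp hd_lim
        rw [ENNReal.toReal_zero] at h1
        have h2 := h1.const_mul (∫ τ in 0..s, K * (s - τ) ^ (-(1 / 2 : ℝ)))
        rwa [mul_zero] at h2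
      rw [tendsto_iff_norm_sub_tendsto_zero]
      exact squeeze_zero' (Eventually.of_forall fun _ => norm_nonneg _) hdiffint hlim0
    -- combine (a), (b), (c) with the identities at time `s`
    have hsum := hLb.add hLc
    have hLa' : Tendsto (fun R : ℝ => ∫ x, ⟪v s x, solenoidalTruncation ψ R x⟫) atTop
        (𝓝 ((∫ x, ⟪u₀ x, heatTest ν φ t x⟫) + ∫ τ in 0..s, N τ)) :=
      hsum.congr' (by
        filter_upwards [eventually_gt_atTop 0] with R hR
        exact (hIdR R hR).symm)
    exact tendsto_nhds_unique hLa hLa'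
  -- ### Step B: the identity at time `t`, and the subtraction
  have hB := hv.2 t htT φ hφ hdiv
  simp only [Pi.zero_apply, inner_zero_left, integral_zero, intervalIntegral.integral_zero,
    add_zero] at hB
  change ∫ x, ⟪v t x, φ x⟫ = (∫ x, ⟪u₀ x, heatTest ν φ t x⟫) + ∫ τ in 0..t, N τ at hB
  have hsplit : ∫ τ in 0..t, N τ = (∫ τ in 0..s, N τ) + ∫ τ in s..t, N τ :=
    (intervalIntegral.integral_add_adjacent_intervals hN_int_s hN_int_st).symm
  simp only [Pi.zero_apply, inner_zero_left, integral_zero, intervalIntegral.integral_zero,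
    add_zero]
  change ∫ x, ⟪v t x, φ x⟫ = (∫ x, ⟪v s x, ψ x⟫) + ∫ τ in s..t, N τ
  rw [hB, hsplit, hA]
  ring

end Restart

end Literature.Analysis.FluidPDE

end
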